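import Literature.MathematicalPhysics.QuantumLattice.HubbardNNNHoppingThermodynamicLimit
import Literature.MathematicalPhysics.QuantumLattice.HubbardGaugeBound
import Literature.MathematicalPhysics.QuantumLattice.ChargeIndexExactSymmetry
import HarnessLib

/-!
# The model-form residual between one-body OBJECTS of a one-band box: adding or dropping a
# hopping graph moves every sector ground energy by at most its operator norm

Venture CertifiedManyBodySolver, cell `pub/hubbard-downfold` (stage S1), seat hubbard-downfold-mod-1;
namespace `Summit.Ventures.CertifiedManyBodySolver.Downfold`. Everything here is PROVED (finite
volume; no thermodynamic limit is taken). HONEST FRAMING: this is the GENERIC energy transport across a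
one-body model-form residual — it is deliberately crude (operator norm), and it says nothing about
dimensionless / order words, which have no generic transport at all.

Context (`router/BOX-SCHEMA.md` v0.3 §1 / §8, lead ruling 2026-08-26T18:45Z «object tags»). A
material's one-band block carries two tagged one-body objects: M = the Wannier (MLWF) Hamiltonian of
the isolated band truncated at printed range (`t, t', t'', t''' …`) and E = the best `t–t'`-only refit.
Stage S2 certifies words for the `t–t'` family (`hubbardRectTorusTT'`, two hopping graphs); object M
has further hopping graphs. On a finite lattice `Λ` every extra range is one more
`hamiltonian G'' t'' 0` added to a Hermitian, particle-number-conserving `H`, and: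

* `exists_unit_groundState_of_preservesSectors` — a normalised ground vector exists in every sector
  `N ≤ 2|Λ|` of a Hermitian sector-preserving `H` (the two-graph lemma of
  `HubbardNNNHoppingThermodynamicLimit`, stated for any such `H`).
* `groundEnergy_le_groundEnergy_add_norm` / `abs_groundEnergy_sub_groundEnergy_le_norm` — WEYL IN A
  SECTOR: `|E_N(A) − E_N(B)| ≤ ‖A − B‖` for Hermitian sector-preserving `A, B` (variational principle
  with the other matrix's ground vector; `‖·‖` = the `ℓ²` operator norm).
* `norm_hamiltonian_zero_le` — `‖hamiltonian G t 0‖ ≤ 2|t| · #{ordered adjacent pairs of G}`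
  (Koma–Tasaki's `‖T(w)‖ ≤ Σ_{u∼v} 2|w(u,v)|`, `HubbardGaugeBound.norm_hoppingForm_le`), and
  `≤ 2|t| Δ |Λ|` on a graph of maximal degree `Δ`.
* `abs_groundEnergy_add_hopping_sub_le` — THE RESIDUAL BOUND: for Hermitian sector-preserving `H`,
  `|E_N(H + hamiltonian G'' t'' 0) − E_N(H)| ≤ 2 |t''| Δ'' |Λ|`, i.e. `≤ 2Δ''|t''|` PER SITE
  (square lattice, straight second neighbours `t''`: `Δ'' = 4` ⇒ `8|t''|`; third neighbours `(2a, a)`: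
  `Δ''' = 8`). With La₂CuO₄'s printed `t'' = 0.042 eV`, `t''' = 0.024 eV` the per-site pad is
  `≈ 0.34 + 0.38 eV` — larger than `J`: the generic transport of ENERGY words across the M/E residual is
  nearly void, which is the quantitative content of «t–t′ truncation is a model-form error, not a
  parameter width» (BOX-SCHEMA §8 (iii)); sharper, state-dependent bounds (`z·n·|Δt|` as in
  `abs_energyDensityTT'_sub_tPrime_le`) are the robustness seats' business.
-/

namespace Summit.Ventures.CertifiedManyBodySolver.Downfold

open Matrix Literature.MathematicalPhysics.QuantumLattice
open scoped ComplexOrder Matrix.Norms.L2Operator InnerProductSpace Finset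

section SectorWeyl

variable {Λ : Type*} [LinearOrder Λ] [Fintype Λ]

/-- A normalised ground vector exists in every sector `N ≤ 2|Λ|` of a Hermitian matrix that is block
diagonal in the particle number (`PreservesSectors`). [folklore] -/
theorem exists_unit_groundState_of_preservesSectors {H : Matrix (Finset (Orb Λ)) (Finset (Orb Λ)) ℂ}
    (hHerm : H.IsHermitian) (hpres : PreservesSectors H) {N : ℕ} (hN : N ≤ 2 * Fintype.card Λ) :
    ∃ ψ : Fock (Orb Λ), IsNParticle N ψ ∧ star ψ ⬝ᵥ ψ = 1 ∧
      H *ᵥ ψ = ((groundEnergy H N : ℝ) : ℂ) • ψ := by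
  classical
  have hc : N ≤ (Finset.univ : Finset (Orb Λ)).card := by rwa [Finset.card_univ, card_orb]
  obtain ⟨s₀, -, hs₀⟩ := Finset.exists_subset_card_eq hc
  have hp : ∃ s : Finset (Orb Λ), s.card = N := ⟨s₀, hs₀⟩
  have hinv : ∀ s s' : Finset (Orb Λ), ¬(s.card = N) → s'.card = N → H s s' = 0 := by
    intro s s' hs hs'
    by_contra h
    have := hpres s s' h
    apply hs
    rw [card_eq_upPart_add_downPart, this.1, this.2, ← card_eq_upPart_add_downPart, hs']
  obtain ⟨⟨v, hv, hv0, hHv⟩, -⟩ := sector_groundState H hHerm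
    (fun s : Finset (Orb Λ) => s.card = N) hp hinv (nParticleSubmodule N) (fun v => Iff.rfl)
  obtain ⟨c, -, hc1⟩ := exists_smul_unit hv0
  refine ⟨c • v, Submodule.smul_mem _ c hv, hc1, ?_⟩
  rw [mulVec_smul, hHv, smul_comm,
    groundEnergy_eq_minEnergyOn H N (nParticleSubmodule N) fun ψ => Iff.rfl]

/-- **Weyl's inequality in a particle-number sector (one-sided).** For Hermitian sector-preserving
`A, B` and `N ≤ 2|Λ|`: `E_N(A) ≤ E_N(B) + ‖A − B‖` (the normalised sector ground vector of `B` is a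
trial vector for `A`; `|⟨ψ, (A − B)ψ⟩| ≤ ‖A − B‖`). [folklore] -/
theorem groundEnergy_le_groundEnergy_add_norm {A B : Matrix (Finset (Orb Λ)) (Finset (Orb Λ)) ℂ}
    (hB : B.IsHermitian) (hBp : PreservesSectors B) {N : ℕ} (hN : N ≤ 2 * Fintype.card Λ) :
    groundEnergy A N ≤ groundEnergy B N + ‖A - B‖ := by
  classical
  obtain ⟨ψ, hψN, hψ1, hBψ⟩ := exists_unit_groundState_of_preservesSectors hB hBp hN
  have h1 : groundEnergy A N ≤ (expect A ψ).re := LiebThm1.groundEnergy_le_re_expect A hψN hψ1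
  have hsplit : expect A ψ = expect B ψ + star ψ ⬝ᵥ ((A - B) *ᵥ ψ) := by
    simp only [expect, sub_mulVec, dotProduct_sub]; ring
  have hB' : expect B ψ = ((groundEnergy B N : ℝ) : ℂ) := by
    simp only [expect, hBψ, dotProduct_smul, hψ1, smul_eq_mul, mul_one]
  have h2 : (star ψ ⬝ᵥ ((A - B) *ᵥ ψ)).re ≤ ‖A - B‖ :=
    (Complex.re_le_norm _).trans (norm_expect_le_norm hψ1 (A - B))
  rw [hsplit, Complex.add_re, hB', Complex.ofReal_re] at h1
  linarith

/-- **Weyl's inequality in a particle-number sector.** For Hermitian sector-preserving `A, B` and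
`N ≤ 2|Λ|`: `|E_N(A) − E_N(B)| ≤ ‖A − B‖`. [folklore] -/
theorem abs_groundEnergy_sub_groundEnergy_le_norm {A B : Matrix (Finset (Orb Λ)) (Finset (Orb Λ)) ℂ}
    (hA : A.IsHermitian) (hAp : PreservesSectors A) (hB : B.IsHermitian) (hBp : PreservesSectors B)
    {N : ℕ} (hN : N ≤ 2 * Fintype.card Λ) :
    |groundEnergy A N - groundEnergy B N| ≤ ‖A - B‖ := by
  have h1 := groundEnergy_le_groundEnergy_add_norm (A := A) hB hBp hN
  have h2 := groundEnergy_le_groundEnergy_add_norm (A := B) hA hAp hN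
  rw [← norm_neg, neg_sub] at h2
  rw [abs_le]
  constructor <;> linarith

end SectorWeyl

section HoppingNorm

variable {Λ : Type*} [LinearOrder Λ] [Fintype Λ] (G : SimpleGraph Λ) [DecidableRel G.Adj]

/-- The pure hopping Hamiltonian is `-t T(1)`: `hamiltonian G t 0 = -t • hoppingForm G 1`.
[folklore] -/
theorem hamiltonian_zero_eq_smul_hoppingForm (t : ℝ) :
    hamiltonian G t 0 = -(t : ℂ) • hoppingForm G (fun _ _ => 1) := by
  have h := hamiltonianWith_eq_hoppingForm G t 0 0
  rw [hamiltonianWith_zero] at h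
  rw [h, densityTerms]
  simp

/-- **Norm of a hopping Hamiltonian**: `‖hamiltonian G t 0‖ ≤ 2|t| · #{(u, v) : u ∼ v}` (ordered
adjacent pairs; Koma–Tasaki's `‖c†_{uσ} c_{vσ}‖ ≤ 1`, two spins). [folklore] -/
theorem norm_hamiltonian_zero_le (t : ℝ) :
    ‖hamiltonian G t 0‖ ≤ 2 * |t| * ∑ u : Λ, ((Finset.univ.filter fun v => G.Adj u v).card : ℝ) := by
  rw [hamiltonian_zero_eq_smul_hoppingForm, norm_smul, norm_neg, Complex.norm_real, Real.norm_eq_abs]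
  have h := norm_hoppingForm_le G (fun _ _ => (1 : ℝ))
  have hsum : (∑ u : Λ, ∑ v : Λ, if G.Adj u v then 2 * |(1 : ℝ)| else 0) =
      2 * ∑ u : Λ, ((Finset.univ.filter fun v => G.Adj u v).card : ℝ) := by
    rw [Finset.mul_sum]
    refine Finset.sum_congr rfl fun u _ => ?_
    rw [abs_one, mul_one, Finset.sum_ite, Finset.sum_const_zero, add_zero, Finset.sum_const,
      nsmul_eq_mul, mul_comm]
  rw [hsum] at h
  calc |t| * ‖hoppingForm G fun _ _ => (1 : ℝ)‖
      ≤ |t| * (2 * ∑ u : Λ, ((Finset.univ.filter fun v => G.Adj u v).card : ℝ)) :=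
        mul_le_mul_of_nonneg_left h (abs_nonneg t)
    _ = 2 * |t| * ∑ u : Λ, ((Finset.univ.filter fun v => G.Adj u v).card : ℝ) := by ring

/-- On a graph of maximal degree `Δ`: `‖hamiltonian G t 0‖ ≤ 2|t| Δ |Λ|`. [folklore] -/
theorem norm_hamiltonian_zero_le_of_degree {Δ : ℕ} (hΔ : ∀ x : Λ, #{y | G.Adj x y} ≤ Δ) (t : ℝ) :
    ‖hamiltonian G t 0‖ ≤ 2 * |t| * Δ * Fintype.card Λ := by
  refine (norm_hamiltonian_zero_le G t).trans ?_
  have hs : ∑ u : Λ, ((Finset.univ.filter fun v => G.Adj u v).card : ℝ) ≤ Δ * Fintype.card Λ := by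
    calc ∑ u : Λ, ((Finset.univ.filter fun v => G.Adj u v).card : ℝ) ≤ ∑ _u : Λ, (Δ : ℝ) :=
          Finset.sum_le_sum fun u _ => by exact_mod_cast hΔ u
      _ = Δ * Fintype.card Λ := by rw [Finset.sum_const, Finset.card_univ, nsmul_eq_mul, mul_comm]
  have h2t : 0 ≤ 2 * |t| := by positivity
  calc 2 * |t| * ∑ u : Λ, ((Finset.univ.filter fun v => G.Adj u v).card : ℝ)
      ≤ 2 * |t| * (Δ * Fintype.card Λ) := mul_le_mul_of_nonneg_left hs h2t
    _ = 2 * |t| * Δ * Fintype.card Λ := by ring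

end HoppingNorm

section Residual

variable {Λ : Type*} [LinearOrder Λ] [Fintype Λ]

/-- **The model-form residual bound (finite volume).** Let `H` be Hermitian and particle-number
conserving (e.g. the `t–t'` Hubbard Hamiltonian of object E, or any sum of hopping graphs plus the
on-site repulsion), and add one more hopping graph `G''` of maximal degree `Δ''` with amplitude `t''`
(a dropped range of object M). Then in every sector `N ≤ 2|Λ|`:
`|E_N(H + hamiltonian G'' t'' 0) − E_N(H)| ≤ 2 |t''| Δ'' |Λ|` — at most `2Δ''|t''|` per site.
[folklore] -/
theorem abs_groundEnergy_add_hopping_sub_le {H : Matrix (Finset (Orb Λ)) (Finset (Orb Λ)) ℂ}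
    (hH : H.IsHermitian) (hHp : PreservesSectors H) (G'' : SimpleGraph Λ) [DecidableRel G''.Adj]
    {Δ : ℕ} (hΔ : ∀ x : Λ, #{y | G''.Adj x y} ≤ Δ) (t'' : ℝ) {N : ℕ} (hN : N ≤ 2 * Fintype.card Λ) :
    |groundEnergy (H + hamiltonian G'' t'' 0) N - groundEnergy H N| ≤
      2 * |t''| * Δ * Fintype.card Λ := by
  have hX : (hamiltonian G'' t'' 0).IsHermitian := LiebThm1.hamiltonian_isHermitian G'' t'' 0
  have hXp : PreservesSectors (hamiltonian G'' t'' 0) := LiebThm1.preservesSectors_hamiltonian G'' t'' 0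
  have h := abs_groundEnergy_sub_groundEnergy_le_norm (hH.add hX) (hHp.add hXp) hH hHp hN
  rw [add_sub_cancel_left] at h
  exact h.trans (norm_hamiltonian_zero_le_of_degree G'' hΔ t'')

/-- Per-site form of the residual bound: `|E_N(H + T'') − E_N(H)| / |Λ| ≤ 2Δ''|t''|` (`|Λ| ≥ 1`).
[folklore] -/
theorem abs_groundEnergy_add_hopping_sub_div_le {H : Matrix (Finset (Orb Λ)) (Finset (Orb Λ)) ℂ}
    (hH : H.IsHermitian) (hHp : PreservesSectors H) (G'' : SimpleGraph Λ) [DecidableRel G''.Adj]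
    {Δ : ℕ} (hΔ : ∀ x : Λ, #{y | G''.Adj x y} ≤ Δ) (t'' : ℝ) {N : ℕ} (hN : N ≤ 2 * Fintype.card Λ)
    (hΛ : 0 < Fintype.card Λ) :
    |groundEnergy (H + hamiltonian G'' t'' 0) N - groundEnergy H N| / Fintype.card Λ ≤
      2 * |t''| * Δ := by
  have hc : (0 : ℝ) < Fintype.card Λ := by exact_mod_cast hΛ
  rw [div_le_iff₀ hc]
  exact abs_groundEnergy_add_hopping_sub_le hH hHp G'' hΔ t'' hN

/-- **Lower-bound transport across the residual**: a certified floor `L ≤ E_N(H)` for the truncated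
object gives `L − 2|t''|Δ''|Λ| ≤ E_N(H + T'')` for the longer-range object (and symmetrically).
[folklore] -/
theorem groundEnergy_add_hopping_ge_of_le {H : Matrix (Finset (Orb Λ)) (Finset (Orb Λ)) ℂ}
    (hH : H.IsHermitian) (hHp : PreservesSectors H) (G'' : SimpleGraph Λ) [DecidableRel G''.Adj]
    {Δ : ℕ} (hΔ : ∀ x : Λ, #{y | G''.Adj x y} ≤ Δ) (t'' : ℝ) {N : ℕ} (hN : N ≤ 2 * Fintype.card Λ)
    {L : ℝ} (hL : L ≤ groundEnergy H N) :
    L - 2 * |t''| * Δ * Fintype.card Λ ≤ groundEnergy (H + hamiltonian G'' t'' 0) N := by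
  have h := abs_groundEnergy_add_hopping_sub_le hH hHp G'' hΔ t'' hN
  rw [abs_le] at h
  linarith [h.1]

/-- **Upper-bound transport across the residual**: `E_N(H) ≤ R` gives
`E_N(H + T'') ≤ R + 2|t''|Δ''|Λ|`. [folklore] -/
theorem groundEnergy_add_hopping_le_of_le {H : Matrix (Finset (Orb Λ)) (Finset (Orb Λ)) ℂ}
    (hH : H.IsHermitian) (hHp : PreservesSectors H) (G'' : SimpleGraph Λ) [DecidableRel G''.Adj]
    {Δ : ℕ} (hΔ : ∀ x : Λ, #{y | G''.Adj x y} ≤ Δ) (t'' : ℝ) {N : ℕ} (hN : N ≤ 2 * Fintype.card Λ)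
    {R : ℝ} (hR : groundEnergy H N ≤ R) :
    groundEnergy (H + hamiltonian G'' t'' 0) N ≤ R + 2 * |t''| * Δ * Fintype.card Λ := by
  have h := abs_groundEnergy_add_hopping_sub_le hH hHp G'' hΔ t'' hN
  rw [abs_le] at h
  linarith [h.2]

/-- The `t–t'` torus Hamiltonian of object E qualifies as the base `H` (Hermitian and
particle-number conserving). [folklore] -/
theorem hubbardRectTorusTT'_preservesSectors (a b : ℕ) (t t' U : ℝ) :
    (hubbardRectTorusTT' a b t t' U).IsHermitian ∧ PreservesSectors (hubbardRectTorusTT' a b t t' U) :=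
  ⟨hubbardRectTorusTT'_isHermitian a b t t' U,
    (LiebThm1.preservesSectors_hamiltonian _ t U).add (LiebThm1.preservesSectors_hamiltonian _ t' 0)⟩

end Residual

end Summit.Ventures.CertifiedManyBodySolver.Downfold
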